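import Summits.KontsevichZagierPeriods.KontsevichZagierPeriods.Theses.FurushoPentagon
import Literature.NumberTheory.Transcendental.KZHomotopyMoves
import Literature.NumberTheory.Transcendental.KZProductIdeal
import Literature.NumberTheory.Transcendental.KZSemiCanonicalReductionProofs
import Literature.NumberTheory.Transcendental.KZLogCalculusProofs
import Literature.NumberTheory.Transcendental.SemialgebraicMapsProofs

/-!
# `DoubleShuffleInKZ` (stmt-KontsevichZagierPeriods-14665, route `FurushoPentagon`): rider lever, analytic lemmas

Helper file (`--supports stmt-KontsevichZagierPeriods-14665`), line "rider lever" for the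
Kaneko–Yamamoto integral–series family `IS_j(u)` (to which the item is equivalent,
`IntegralSeries.doubleShuffleInKZ_of_integralSeriesFamily`).  Abstract analytic lemmas (no multiple
zeta values) feeding the lever `rider_lever` of the sibling file
`FurushoPentagonDoubleShuffleInKZRiderLever.lean` (the dilation lever of the `HoffmanRelationInKZ`
line at an arbitrary active coordinate `i₀`, with a passive rider chain):

* §1 the one-dimensional calculus of the scaled family `λ ↦ λ f(w|_{i₀ := λ a})` (derivative
  `k(w|_{i₀ := λ a})`, continuity on `[0,1]`, FTC on the fibres `λ ∈ [s,1]` for a kernel `k ≥ 0`);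
* §2 Tonelli along the last coordinate as an IDENTITY of lower integrals on a band
  (`lintegral_band_eq`), so that absolute convergence can be read upwards as well as downwards;
* §3 the null sets met by the transposition `λ ↔ w i₀`: coordinate hyperplanes and the "graph of
  the floor" `{w ∈ P | w i₀ = c w}` for a floor `c` independent of `w i₀`.

References: M. Kontsevich, D. Zagier, *Periods* (2001), §1.2; M. E. Hoffman, Pacific J. Math. 152
(1992), Thm 5.1; M. Kaneko, S. Yamamoto, Selecta Math. 24 (2018), Thm 4.1.
-/

noncomputable section

open Set MeasureTheory Function
open Literature.NumberTheory.Transcendental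
open Literature.ModelTheory.ExponentialFields (IsSemialgebraic)

namespace Summit.KontsevichZagierPeriods.FurushoPentagon.DoubleShuffleInKZ

variable {N : ℕ}

/-! ### 1. One-dimensional calculus of the scaled family `λ ↦ λ f(w|_{i₀ := λ a})` -/

/-- The scaled primitive: `λ f(w|_{i₀ := λ a}) = g(λ a)/a` with `g(b) = b f(w|_{i₀ := b})`, so its
derivative in `λ` is `k(w|_{i₀ := λ a})`. [folklore] -/
theorem lever_scaled_hasDerivAt (i₀ : Fin N) (f k : (Fin N → ℝ) → ℝ) (w : Fin N → ℝ) {a : ℝ}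
    (ha : 0 < a)
    (hder : ∀ b ∈ Ioo (0:ℝ) 1, HasDerivAt (fun b : ℝ => b * f (update w i₀ b)) (k (update w i₀ b)) b)
    {l : ℝ} (hl : 0 < l) (hla : l * a < 1) :
    HasDerivAt (fun l : ℝ => l * f (update w i₀ (l * a))) (k (update w i₀ (l * a))) l := by
  have hb : l * a ∈ Ioo (0:ℝ) 1 := ⟨mul_pos hl ha, hla⟩
  have h1 : HasDerivAt (fun l : ℝ => l * a) a l := by
    simpa using (hasDerivAt_id l).mul_const a
  have h2 := (hder (l * a) hb).comp l h1
  have h3 : HasDerivAt (fun l : ℝ => a⁻¹ * ((l * a) * f (update w i₀ (l * a))))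
      (a⁻¹ * (k (update w i₀ (l * a)) * a)) l := h2.const_mul a⁻¹
  have heq : (fun l : ℝ => a⁻¹ * ((l * a) * f (update w i₀ (l * a)))) =
      fun l : ℝ => l * f (update w i₀ (l * a)) := by
    funext l; field_simp
  rw [heq] at h3
  convert h3 using 1
  field_simp

/-- The scaled primitive is continuous on `λ ∈ [0,1]` when `0 < a < 1` and
`b ↦ b f(w|_{i₀ := b})` is continuous on `[0,1)`. [folklore] -/
theorem lever_scaled_continuousOn (i₀ : Fin N) (f : (Fin N → ℝ) → ℝ) (w : Fin N → ℝ) {a : ℝ}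
    (ha : 0 < a) (ha1 : a < 1)
    (hcont : ContinuousOn (fun b : ℝ => b * f (update w i₀ b)) (Ico 0 1)) :
    ContinuousOn (fun l : ℝ => l * f (update w i₀ (l * a))) (Icc 0 1) := by
  have h1 : ContinuousOn (fun l : ℝ => l * a) (Icc 0 1) := (continuous_id.mul continuous_const).continuousOn
  have hmaps : MapsTo (fun l : ℝ => l * a) (Icc 0 1) (Ico 0 1) := fun l hl =>
    ⟨mul_nonneg hl.1 ha.le, by nlinarith [hl.2]⟩
  have h2 := hcont.comp h1 hmaps
  refine (h2.const_smul a⁻¹).congr (fun l _ => ?_)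
  simp only [Function.comp_apply, Pi.smul_apply, smul_eq_mul]
  field_simp

/-- **FTC on a fibre.** For `0 < a < 1` and `0 ≤ s ≤ 1`: the kernel `λ ↦ k(w|_{i₀ := λ a})` is
integrable on `[s, 1]` and `∫_s^1 k(w|_{i₀ := λ a}) dλ = f(w|_{i₀ := a}) − s f(w|_{i₀ := s a})`
(derivative `≥ 0`, `intervalIntegral.integrableOn_deriv_of_nonneg`). [folklore] -/
theorem lever_fibre_integral (i₀ : Fin N) (f k : (Fin N → ℝ) → ℝ) (w : Fin N → ℝ) {a : ℝ}
    (ha : 0 < a) (ha1 : a < 1)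
    (hder : ∀ b ∈ Ioo (0:ℝ) 1, HasDerivAt (fun b : ℝ => b * f (update w i₀ b)) (k (update w i₀ b)) b)
    (hcont : ContinuousOn (fun b : ℝ => b * f (update w i₀ b)) (Ico 0 1))
    (hk0 : ∀ b ∈ Ioo (0:ℝ) 1, 0 ≤ k (update w i₀ b)) {s : ℝ} (hs0 : 0 ≤ s) (hs1 : s ≤ 1) :
    IntegrableOn (fun l : ℝ => k (update w i₀ (l * a))) (Icc s 1) ∧
    ∫ l in Icc s 1, k (update w i₀ (l * a)) = f (update w i₀ a) - s * f (update w i₀ (s * a)) := by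
  have hD : ∀ l ∈ Ioo s 1, HasDerivAt (fun l : ℝ => l * f (update w i₀ (l * a)))
      (k (update w i₀ (l * a))) l := fun l hl =>
    lever_scaled_hasDerivAt i₀ f k w ha hder (hs0.trans_lt hl.1) (by nlinarith [hl.2])
  have hC : ContinuousOn (fun l : ℝ => l * f (update w i₀ (l * a))) (Icc s 1) :=
    (lever_scaled_continuousOn i₀ f w ha ha1 hcont).mono (Icc_subset_Icc_left hs0)
  have hnn : ∀ l ∈ Ioo s 1, 0 ≤ k (update w i₀ (l * a)) := fun l hl =>
    hk0 _ ⟨mul_pos (hs0.trans_lt hl.1) ha, by nlinarith [hl.2]⟩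
  have hint : IntegrableOn (fun l : ℝ => k (update w i₀ (l * a))) (Icc s 1) := by
    have h := intervalIntegral.integrableOn_deriv_of_nonneg hC hD hnn
    exact (integrableOn_Icc_iff_integrableOn_Ioc).mpr h
  refine ⟨hint, ?_⟩
  rw [integral_Icc_eq_integral_Ioc, ← intervalIntegral.integral_of_le hs1,
    intervalIntegral.integral_eq_sub_of_hasDerivAt_of_le hs1 hC hD
      ((intervalIntegrable_iff_integrableOn_Icc_of_le hs1).mpr hint)]
  simp


/-! ### 2. Tonelli along the last coordinate (exact form) -/

/-- **Tonelli on a band, as an identity**: for a band `B = {(x,t) | x ∈ S, a x ≤ t ≤ b x}` and a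
function `W` a.e.-strongly measurable on `B`,
`∫⁻_B ‖W‖ = ∫⁻_{x ∈ S} ∫⁻_{t ∈ [a x, b x]} ‖W(x,t)‖` (volume-preserving `ℝᵐ⁺¹ ≃ ℝ × ℝᵐ`). [folklore] -/
theorem lintegral_band_eq {S : Set (Fin N → ℝ)} (hS : MeasurableSet S)
    {a b : (Fin N → ℝ) → ℝ} {B : Set (Fin (N + 1) → ℝ)} (hB : MeasurableSet B)
    (hmem : ∀ (x : Fin N → ℝ) (t : ℝ),
      (Fin.snoc x t : Fin (N + 1) → ℝ) ∈ B ↔ x ∈ S ∧ t ∈ Icc (a x) (b x))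
    {W : (Fin (N + 1) → ℝ) → ℝ} (hW : AEStronglyMeasurable W (volume.restrict B)) :
    ∫⁻ z in B, ‖W z‖ₑ = ∫⁻ x in S, ∫⁻ t in Icc (a x) (b x), ‖W (Fin.snoc x t)‖ₑ := by
  set e : (Fin (N + 1) → ℝ) ≃ᵐ ℝ × (Fin N → ℝ) :=
    MeasurableEquiv.piFinSuccAbove (fun _ => ℝ) (Fin.last N) with he_def
  have he : MeasurePreserving e volume volume :=
    volume_preserving_piFinSuccAbove (fun _ => ℝ) (Fin.last N)
  have he_symm : ∀ p : ℝ × (Fin N → ℝ), e.symm p = Fin.snoc p.2 p.1 := fun p => by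
    simp [he_def, MeasurableEquiv.piFinSuccAbove, Fin.snocEquiv]
  -- pass to the indicator and transport along `e`
  have hind : AEMeasurable (B.indicator fun z => ‖W z‖ₑ) volume :=
    (aemeasurable_indicator_iff hB).2 hW.enorm
  rw [← lintegral_indicator hB]
  have h1 : ∫⁻ z, B.indicator (fun z => ‖W z‖ₑ) z ∂volume =
      ∫⁻ p, B.indicator (fun z => ‖W z‖ₑ) (e.symm p) ∂(volume : Measure (ℝ × (Fin N → ℝ))) := by
    rw [← (MeasurePreserving.symm e he).lintegral_comp_emb e.symm.measurableEmbedding]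
  rw [h1]
  have hind' : AEMeasurable (fun p : ℝ × (Fin N → ℝ) => B.indicator (fun z => ‖W z‖ₑ) (e.symm p))
      ((volume : Measure ℝ).prod (volume : Measure (Fin N → ℝ))) := by
    have h := ((MeasurePreserving.symm e he).aemeasurable_comp_iff
      e.symm.measurableEmbedding).mpr hind
    rw [Measure.volume_eq_prod] at h
    exact h
  rw [Measure.volume_eq_prod, lintegral_prod_symm _ hind']
  simp_rw [he_symm]
  -- fibrewise, the indicator of the band is the indicator of `S` times that of the fibre
  have h2 : ∀ (x : Fin N → ℝ) (t : ℝ), B.indicator (fun z => ‖W z‖ₑ) (Fin.snoc x t) =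
      S.indicator (fun x => (Icc (a x) (b x)).indicator (fun t => ‖W (Fin.snoc x t)‖ₑ) t) x := by
    intro x t
    by_cases hx : x ∈ S
    · by_cases ht : t ∈ Icc (a x) (b x)
      · rw [indicator_of_mem ((hmem x t).2 ⟨hx, ht⟩), indicator_of_mem hx, indicator_of_mem ht]
      · rw [indicator_of_notMem (fun h => ht ((hmem x t).1 h).2), indicator_of_mem hx,
          indicator_of_notMem ht]
    · rw [indicator_of_notMem (fun h => hx ((hmem x t).1 h).1), indicator_of_notMem hx]
  simp_rw [h2]
  rw [← lintegral_indicator hS]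
  refine lintegral_congr fun x => ?_
  by_cases hx : x ∈ S
  · simp only [indicator_of_mem hx]
    rw [lintegral_indicator measurableSet_Icc]
  · simp only [indicator_of_notMem hx, lintegral_zero]

/-! ### 3. Null sets: coordinate hyperplanes and the graph of the floor -/

/-- A coordinate hyperplane `{w | w i = t}` of `ℝᴺ` is Lebesgue-null. [folklore] -/
theorem volume_setOf_apply_eq_const (i : Fin N) (t : ℝ) :
    volume {w : Fin N → ℝ | w i = t} = 0 := by
  rw [volume_pi]
  exact Measure.pi_hyperplane (fun _ : Fin N => (volume : Measure ℝ)) i t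

/-- The zero set `{w ∈ P | g w = 0}` of a semialgebraic function is semialgebraic
(`P` minus two strict sublevel sets). [cite: BochnakCosteRoy1998, §2.2] -/
theorem isSemialgebraic_sep_eq_zero {P : Set (Fin N → ℝ)} {g : (Fin N → ℝ) → ℝ}
    (hP : IsSemialgebraic ℚ P) (hg : IsSemialgebraicFunOn ℚ P g) :
    IsSemialgebraic ℚ {w | w ∈ P ∧ g w = 0} := by
  have h1 := hg.isSemialgebraic_sep_lt
    Literature.ModelTheory.ExponentialFields.tarski_seidenberg_real_holds 0 0
  have h2 := hg.neg.isSemialgebraic_sep_lt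
    Literature.ModelTheory.ExponentialFields.tarski_seidenberg_real_holds 0 0
  convert hP.diff (h1.union h2) using 1
  ext w
  simp only [mem_setOf_eq, mem_sdiff, mem_union, Pi.neg_apply, Nat.cast_zero, zero_add, one_mul,
    Int.cast_zero, neg_lt_zero, not_or]
  constructor
  · rintro ⟨hw, h0⟩
    exact ⟨hw, fun h => by linarith [h.2], fun h => by linarith [h.2]⟩
  · rintro ⟨hw, ha, hb⟩
    have ha' : 0 ≤ g w := by
      by_contra h; exact ha ⟨hw, lt_of_not_ge h⟩
    have hb' : g w ≤ 0 := by
      by_contra h; exact hb ⟨hw, lt_of_not_ge h⟩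
    exact ⟨hw, le_antisymm hb' ha'⟩

/-- **The graph of the floor is null**: if `c` is semialgebraic on `P` and does not depend on the
coordinate `i₀`, then `{w ∈ P | w i₀ = c w}` is Lebesgue-null (after the volume-preserving split
`ℝᴺ ≃ ℝ × ℝᴺ⁻¹` along `i₀`, its fibres are single points). [folklore] -/
theorem volume_sep_apply_eq_floor_eq_zero (i₀ : Fin N) {P : Set (Fin N → ℝ)}
    (hP : IsSemialgebraic ℚ P) {c : (Fin N → ℝ) → ℝ} (hc : IsSemialgebraicFunOn ℚ P c)
    (hcupd : ∀ (w : Fin N → ℝ) (b : ℝ), c (update w i₀ b) = c w) :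
    volume {w : Fin N → ℝ | w ∈ P ∧ w i₀ = c w} = 0 := by
  obtain ⟨n, rfl⟩ : ∃ n, N = n + 1 := ⟨N - 1, (Nat.succ_pred_eq_of_pos (Fin.pos i₀)).symm⟩
  set E : Set (Fin (n + 1) → ℝ) := {w | w ∈ P ∧ w i₀ = c w} with hE_def
  have hEsa : IsSemialgebraic ℚ E := by
    have hg : IsSemialgebraicFunOn ℚ P (fun w => w i₀ - c w) :=
      IsSemialgebraicFunOn.sub_holds (isSemialgebraicFunOn_apply hP i₀) hc
    convert isSemialgebraic_sep_eq_zero hP hg using 1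
    ext w
    simp only [hE_def, mem_setOf_eq, sub_eq_zero]
  have hEm : MeasurableSet E := IsSemialgebraic.measurableSet_holds hEsa
  set e : (Fin (n + 1) → ℝ) ≃ᵐ ℝ × (Fin n → ℝ) :=
    MeasurableEquiv.piFinSuccAbove (fun _ => ℝ) i₀ with he_def
  have he : MeasurePreserving e volume volume := volume_preserving_piFinSuccAbove (fun _ => ℝ) i₀
  have he1 : ∀ w : Fin (n + 1) → ℝ, (e w).1 = w i₀ := fun w => by
    simp [he_def, MeasurableEquiv.piFinSuccAbove]
  have he_symm0 : ∀ w : Fin (n + 1) → ℝ, e.symm (0, (e w).2) = update w i₀ 0 := fun w => by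
    have h : e (update w i₀ 0) = (0, (e w).2) := by
      refine Prod.ext ?_ ?_
      · rw [he1]; simp
      · ext j
        simp [he_def, MeasurableEquiv.piFinSuccAbove, Fin.removeNth]
    rw [← h, e.symm_apply_apply]
  -- `vol E = (vol × vol) (e '' E)`, computed by slicing in the first factor
  have himg : MeasurableSet (e '' E) := e.measurableSet_image.mpr hEm
  have hvol : volume E = volume (e '' E) := by
    rw [← he.measure_preimage (e.measurableSet_image.mpr hEm).nullMeasurableSet, e.preimage_image]
  rw [hvol, Measure.volume_eq_prod, Measure.prod_apply_symm himg]
  have hfib : ∀ y : Fin n → ℝ, volume ((fun x : ℝ => (x, y)) ⁻¹' (e '' E)) = 0 := by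
    intro y
    refine measure_mono_null (fun t ht => ?_) (measure_singleton (c (e.symm (0, y))))
    obtain ⟨w, hw, hwe⟩ := ht
    have h1 : t = w i₀ := by rw [← he1 w, hwe]
    have h2 : y = (e w).2 := by rw [hwe]
    rw [mem_singleton_iff, h1, hw.2, h2, he_symm0, hcupd]
  simp_rw [hfib]
  exact lintegral_zero

end Summit.KontsevichZagierPeriods.FurushoPentagon.DoubleShuffleInKZ
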